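import Summits.CriticalPhenomena.Ising3D.Control2DDiagonalStates
import Mathlib.Analysis.SpecificLimits.Basic
import Mathlib.Analysis.SpecialFunctions.ExpDeriv
import Mathlib.Topology.Algebra.InfiniteSum.ENNReal
import Mathlib.Tactic.Linarith
import Mathlib.Tactic.Positivity
import Mathlib.Tactic.FieldSimp
import Mathlib.Tactic.Ring
import HarnessLib

/-!
# The Abelian tail bound for a weighted discrete family: `Σ'_{E_j ≥ T} w_j e^{-tE_j} ≤ B T^ρ e^{-tT} · tT/(tT - ρ)`
# once the mass below `u` is `≤ B u^ρ` — the integration-by-parts step of Pappadopulo–Rychkov–Espin–Rattazzi 2012 §4.4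
(cell `pub-ising3x`, seat controls-1 gen 46; PAPER §6.2 / Appendix E — CONTROL-ONLY; part 1 of 2, part 2 is
`Control2DConvergenceRateSharp`; sequel to `Control2DDiagonalStates` / `Control2DSpectralDensityAsymptotics`)

HONEST FRAMING: lottery ticket; floor = tightest certified 3D Ising CFT bounds; no exact-solution
claim without a proof. CONTROL-ONLY (`d = 2`, global `sl(2) × sl(2)` blocks, `Δ_σ = s` an INPUT, axiom set
`A2D′`); this part is pure real analysis on a weighted family `(w_j, E_j)` — nothing here is about any CFT, nothing
about `d = 3`, no certificate, functional or number of the record is touched, no new hypothesis or named fact enters.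

WHAT THIS FILE ADDS. PRER 2012 §4.4 pass from the Hardy–Littlewood asymptotics (4.9) `F(E) ∼ E^{2Δ_φ}/Γ(2Δ_φ+1)` of
the integrated weighted spectral density to the CONVERGENCE RATE of the conformal block expansion: the tail
`ℒ(β,E_*) = ∫_{E_*}^∞ f(E) e^{-βE} dE` is integrated by parts, `ℒ(β,E_*) ≤ β ∫_{E_*}^∞ F(E) e^{-Eβ} dE ∼
β^{-2Δ_φ} Γ(2Δ_φ+1, E_*β)/Γ(2Δ_φ+1)` (their (4.17)), and the incomplete-Gamma asymptotics give (4.18)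
`ℒ(β,E_*) ≲ E_*^{2Δ_φ} e^{-E_*β}/Γ(2Δ_φ+1)` — «the OPE expansion for the four point function converges exponentially
fast». This file is the elementary DISCRETE-ABEL version of that step for a weighted discrete family `w_j ≥ 0` at levels
`E_j` with `Σ_j w_j e^{-tE_j} < ∞` (`t > 0`) — the setting of `Control2DDiagonalStates` — with no integral and no special
function:
* `hasSum_layers_geometric` — `Σ_{m ≥ n} r^m (1-r) = r^n`;
* **`tsum_ge_mul_exp_le_layer`** — if `Σ'_{E_j ≤ u} w_j ≤ B u^ρ` for all `u ≥ T` (`T > 0`, `ρ ≥ 0`) and `tT > ρ`, then for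
  every step `h > 0`: `Σ'_{j : T ≤ E_j} w_j e^{-tE_j} ≤ B T^ρ e^{-tT} · (1 - e^{-th}) e^{ρh/T}/(1 - e^{-(t-ρ/T)h})` (layers
  `T + mh ≤ E_j < T + (m+1)h`; `e^{-tE_j} ≤ e^{-tT} r^m = e^{-tT} Σ_{k ≥ m} r^k (1-r)`, `r = e^{-th}`; Tonelli over the
  non-negative double family in `ℝ≥0∞` (`ENNReal.tsum_comm`); the mass below `T + (k+1)h` is `≤ B T^ρ q^{k+1}`,
  `q = e^{ρh/T}`, by `(1+u)^ρ ≤ e^{ρu}`; a geometric series in `rq < 1`);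
* **`tsum_ge_mul_exp_le_of_le_rpow`** — `h → 0⁺` (the slopes `(1 - e^{-ah})/h → a`): `Σ'_{j : T ≤ E_j} w_j e^{-tE_j} ≤
  B T^ρ e^{-tT} · tT/(tT - ρ)`, the factor being exactly the classical bound `Γ(ρ+1, tT) ≤ (tT)^ρ e^{-tT} · tT/(tT-ρ)` that
  PRER use asymptotically;
* **`eventually_tsum_ge_mul_exp_le`** — the asymptotic form: if for every `δ > 0` eventually `Σ'_{E_j ≤ u} w_j ≤ (A+δ)u^ρ`
  (e.g. Karamata, `Control2DSpectralDensityAsymptotics`), then for every `t > 0`, `ε > 0`, eventually in `T`: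
  `Σ'_{j : T ≤ E_j} w_j e^{-tE_j} ≤ (A + ε) T^ρ e^{-tT}` — PRER (4.18) with `A` in place of `1/Γ(2Δ_φ+1)`.
* `tsum_gt_mul_exp_le_of_le_rpow` — the same bound for the STRICT tail `Σ'_{T < E_j}` (the complement of the states counted
  below `T`; a sub-family of the non-strict tail).
Recorded because it makes the constant of `Control2DConvergenceRate` (E.1n) sharp in part 2; only UPPER bounds (no lower
bound on a tail holds pointwise in `T`: the levels may leave gaps of length `o(T)`).

NOT claimed: PRER's logarithmic error term (their (4.12)–(4.13), Korevaar VII); the `ρ`-coordinate rate (their §4.3 /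
(4.19)ff.); any statement about a CFT (part 2 applies this to the typed 2D class only); Virasoro; anything three-dimensional.

References: D. Pappadopulo, S. Rychkov, J. Espin, R. Rattazzi, Phys. Rev. D 86 (2012) 105043, §4.4 (4.16)–(4.18)
[cite: PappadopuloRychkovEspinRattazzi2012PRD, §4.4]. Tree: `summable_subtype_le_of_summable_exp` (`Control2DDiagonalStates`).
Mathlib: `hasSum_iff_tendsto_nat_of_nonneg`, `tendsto_pow_atTop_nhds_zero_of_lt_one`, `hasSum_geometric_of_lt_one`,
`ENNReal.ofReal_tsum_of_nonneg`, `ENNReal.tsum_comm`, `ENNReal.tsum_le_tsum`, `ENNReal.tsum_mul_left`, `tsum_subtype`,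
`Nat.floor_le`, `Nat.lt_floor_add_one`, `Real.add_one_le_exp`, `Real.exp_nat_mul`, `HasDerivAt.tendsto_slope_zero_right`,
`ge_of_tendsto`, `Filter.Tendsto.eventually_lt_const`.
-/

namespace Summit.CriticalPhenomena.Ising3D.Control2D

open Set Filter Topology
open scoped ENNReal

/-! ### A telescoping geometric tail -/

/-- For `0 ≤ r < 1` and `n : ℕ`: `Σ_{m ≥ n} r^m (1 - r) = r^n` — the layers above level `n` telescope (the same
elementary fact as `Literature.Probability.Percolation.hasSum_ite_geometric_tail`, re-proved here so that this module's
closure stays inside the `Control2D` tree and Mathlib). [folklore] -/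
theorem hasSum_layers_geometric {r : ℝ} (hr0 : 0 ≤ r) (hr1 : r < 1) (n : ℕ) :
    HasSum (fun m : ℕ => if n ≤ m then r ^ m * (1 - r) else 0) (r ^ n) := by
  have hnn : ∀ m : ℕ, 0 ≤ (if n ≤ m then r ^ m * (1 - r) else 0 : ℝ) := fun m => by
    split_ifs
    · exact mul_nonneg (pow_nonneg hr0 m) (by linarith)
    · exact le_rfl
  rw [hasSum_iff_tendsto_nat_of_nonneg hnn]
  have hP : ∀ N : ℕ, ∑ m ∈ Finset.range N, (if n ≤ m then r ^ m * (1 - r) else 0 : ℝ) =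
      r ^ n - r ^ (max N n) := by
    intro N
    induction N with
    | zero => simp
    | succ N ih =>
      rw [Finset.sum_range_succ, ih]
      by_cases h : n ≤ N
      · rw [if_pos h, max_eq_left h, max_eq_left (Nat.le_succ_of_le h), pow_succ]
        ring
      · rw [not_le] at h
        rw [if_neg (by omega), max_eq_right h.le, max_eq_right (by omega)]
        ring
  simp_rw [hP]
  have h0 : Tendsto (fun N : ℕ => r ^ (max N n)) atTop (𝓝 0) :=
    (tendsto_pow_atTop_nhds_zero_of_lt_one hr0 hr1).comp
      (tendsto_atTop_mono (fun N => le_max_left N n) tendsto_id)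
  have h := (tendsto_const_nhds (x := r ^ n)).sub h0
  rw [sub_zero] at h
  exact h

/-! ### The Abelian tail bound for a weighted discrete family -/

section AbelTail

variable {J : Type*} {w E : J → ℝ}

/-- **Layer bound** (discrete Abel summation, step `h > 0`). Let `w_j, E_j` be a weighted family with
`Σ_j w_j e^{-tE_j} < ∞` for every `t > 0`, and suppose its mass below `u` obeys `Σ'_{E_j ≤ u} w_j ≤ B·u^ρ` for all
`u ≥ T` (`T > 0`, `ρ ≥ 0`). Then for `t > 0` with `tT > ρ` and every `h > 0`:
`Σ'_{j : T ≤ E_j} w_j e^{-tE_j} ≤ B T^ρ e^{-tT} · (1 - e^{-th}) e^{ρh/T} / (1 - e^{-(t - ρ/T)h})`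
(layers `T + mh ≤ E_j < T + (m+1)h`: `e^{-tE_j} ≤ e^{-tT} r^m = e^{-tT} Σ_{k ≥ m} r^k(1-r)`, `r = e^{-th}`; Tonelli over the
non-negative double family; the mass below `T + (k+1)h` is `≤ B T^ρ q^{k+1}`, `q = e^{ρh/T}`; a geometric series in
`rq = e^{-(t-ρ/T)h} < 1`). [folklore] -/
theorem tsum_ge_mul_exp_le_layer (hw : ∀ j, 0 ≤ w j)
    (hsum : ∀ t : ℝ, 0 < t → Summable fun j => w j * Real.exp (-(t * E j)))
    {B ρ T t h : ℝ} (hρ : 0 ≤ ρ) (hT : 0 < T) (ht : 0 < t) (htT : ρ < t * T) (hh : 0 < h)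
    (hB : ∀ u : ℝ, T ≤ u → ∑' j : ↥({j : J | E j ≤ u} : Set J), w j ≤ B * u ^ ρ) :
    ∑' j : ↥({j : J | T ≤ E j} : Set J), w j * Real.exp (-(t * E j)) ≤
      B * T ^ ρ * Real.exp (-(t * T)) *
        ((1 - Real.exp (-(t * h))) * Real.exp (ρ * h / T) / (1 - Real.exp (-((t - ρ / T) * h)))) := by
  -- the constants
  set r : ℝ := Real.exp (-(t * h)) with hr
  set q : ℝ := Real.exp (ρ * h / T) with hq
  set θ : ℝ := Real.exp (-((t - ρ / T) * h)) with hθ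
  have hr0 : 0 < r := Real.exp_pos _
  have hr1 : r < 1 := Real.exp_lt_one_iff.mpr (by nlinarith)
  have hq0 : 0 < q := Real.exp_pos _
  have hκ : 0 < t - ρ / T := by
    rw [sub_pos, div_lt_iff₀ hT]; linarith
  have hθ1 : θ < 1 := Real.exp_lt_one_iff.mpr (by nlinarith)
  have hθ0 : 0 < θ := Real.exp_pos _
  have hrq : r * q = θ := by
    rw [hr, hq, hθ, ← Real.exp_add]
    congr 1
    field_simp
    ring
  have hTρ : 0 < T ^ ρ := Real.rpow_pos_of_pos hT ρ
  have hB0 : 0 ≤ B := by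
    have h1 := hB T le_rfl
    have h2 : 0 ≤ ∑' j : ↥({j : J | E j ≤ T} : Set J), w j := tsum_nonneg fun j => hw j
    nlinarith
  -- the layer index of a state
  let n : J → ℕ := fun j => ⌊(E j - T) / h⌋₊
  have hn_le : ∀ j, T ≤ E j → T + (n j : ℝ) * h ≤ E j := fun j hj => by
    have h1 : ((n j : ℕ) : ℝ) ≤ (E j - T) / h := Nat.floor_le (div_nonneg (by linarith) hh.le)
    rw [le_div_iff₀ hh] at h1
    linarith
  have hn_lt : ∀ j, E j < T + ((n j : ℝ) + 1) * h := fun j => by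
    have h1 : (E j - T) / h < (n j : ℝ) + 1 := Nat.lt_floor_add_one _
    rw [div_lt_iff₀ hh] at h1
    linarith
  -- pointwise: `w_j e^{-tE_j} ≤ w_j e^{-tT} r^{n_j}` on the tail set
  have hpt : ∀ j, T ≤ E j → w j * Real.exp (-(t * E j)) ≤ w j * (Real.exp (-(t * T)) * r ^ (n j)) := by
    intro j hj
    refine mul_le_mul_of_nonneg_left ?_ (hw j)
    rw [hr, ← Real.exp_nat_mul, ← Real.exp_add]
    exact Real.exp_le_exp.mpr (by nlinarith [hn_le j hj])
  -- the telescoped layers of one state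
  have htel : ∀ j, HasSum (fun m : ℕ => if n j ≤ m then r ^ m * (1 - r) else 0) (r ^ (n j)) := fun j =>
    hasSum_layers_geometric hr0.le hr1 (n j)
  -- the double family, in `ℝ≥0∞`
  let a : J → ℕ → ℝ≥0∞ := fun j m =>
    if n j ≤ m then ENNReal.ofReal (w j * Real.exp (-(t * T)) * (r ^ m * (1 - r))) else 0
  -- (1) each state is dominated by the sum of its layers
  have h1 : ∀ j : ↥({j : J | T ≤ E j} : Set J),
      ENNReal.ofReal (w j * Real.exp (-(t * E j))) ≤ ∑' m, a j m := by
    intro j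
    have hj : T ≤ E (j : J) := j.2
    have hc0 : 0 ≤ w j * Real.exp (-(t * T)) := mul_nonneg (hw j) (Real.exp_pos _).le
    have e1 : ∑' m, a j m = ENNReal.ofReal (w j * (Real.exp (-(t * T)) * r ^ (n j))) := by
      have H := (htel j).mul_left (w j * Real.exp (-(t * T)))
      have hnn : ∀ m : ℕ, 0 ≤ w j * Real.exp (-(t * T)) * (if n j ≤ m then r ^ m * (1 - r) else 0) :=
        fun m => mul_nonneg hc0 (by split_ifs; exact mul_nonneg (pow_nonneg hr0.le m) (by linarith); exact le_rfl)
      rw [show w j * (Real.exp (-(t * T)) * r ^ (n j)) = w j * Real.exp (-(t * T)) * r ^ (n j) by ring,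
        ← H.tsum_eq, ENNReal.ofReal_tsum_of_nonneg hnn H.summable]
      refine tsum_congr fun m => ?_
      show (if n j ≤ m then ENNReal.ofReal (w j * Real.exp (-(t * T)) * (r ^ m * (1 - r))) else 0) = _
      split_ifs
      · rfl
      · rw [mul_zero, ENNReal.ofReal_zero]
    rw [e1]
    exact ENNReal.ofReal_le_ofReal (hpt j hj)
  -- (2) the states in the layers `≤ m` lie below `T + (m+1)h`
  have h2 : ∀ m : ℕ, ∑' j : ↥({j : J | T ≤ E j} : Set J), a j m ≤
      ENNReal.ofReal (Real.exp (-(t * T)) * (r ^ m * (1 - r)) * (B * T ^ ρ * q ^ (m + 1))) := by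
    intro m
    set u : ℝ := T + ((m : ℝ) + 1) * h with hu
    have hTu : T ≤ u := by rw [hu]; nlinarith
    have hc0 : 0 ≤ Real.exp (-(t * T)) * (r ^ m * (1 - r)) :=
      mul_nonneg (Real.exp_pos _).le (mul_nonneg (pow_nonneg hr0.le m) (by linarith))
    -- the indicator family on all of `J`
    have step1 : ∑' j : ↥({j : J | T ≤ E j} : Set J), a j m ≤
        ∑' j : J, ({j : J | E j ≤ u} : Set J).indicator (fun j => ENNReal.ofReal
          (Real.exp (-(t * T)) * (r ^ m * (1 - r))) * ENNReal.ofReal (w j)) j := by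
      rw [tsum_subtype ({j : J | T ≤ E j} : Set J) (fun j => a j m)]
      refine ENNReal.tsum_le_tsum fun j => ?_
      by_cases hjS : j ∈ ({j : J | T ≤ E j} : Set J)
      · rw [indicator_of_mem hjS]
        show (if n j ≤ m then ENNReal.ofReal (w j * Real.exp (-(t * T)) * (r ^ m * (1 - r))) else 0) ≤ _
        by_cases hnm : n j ≤ m
        · have hju : j ∈ ({j : J | E j ≤ u} : Set J) := by
            show E j ≤ u
            have h3 := hn_lt j
            have h4 : ((n j : ℝ) + 1) * h ≤ ((m : ℝ) + 1) * h :=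
              mul_le_mul_of_nonneg_right (by exact_mod_cast Nat.succ_le_succ hnm) hh.le
            rw [hu]; linarith
          rw [if_pos hnm, indicator_of_mem hju, ← ENNReal.ofReal_mul hc0]
          exact ENNReal.ofReal_le_ofReal (le_of_eq (by ring))
        · rw [if_neg hnm]
          exact zero_le
      · rw [indicator_of_notMem hjS]
        exact zero_le
    refine step1.trans ?_
    rw [← tsum_subtype ({j : J | E j ≤ u} : Set J) (fun j => ENNReal.ofReal
          (Real.exp (-(t * T)) * (r ^ m * (1 - r))) * ENNReal.ofReal (w j)), ENNReal.tsum_mul_left,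
      ← ENNReal.ofReal_tsum_of_nonneg (f := fun j : ↥({j : J | E j ≤ u} : Set J) => w j) (fun j => hw j)
        (summable_subtype_le_of_summable_exp hw (hsum 1 one_pos) u),
      ← ENNReal.ofReal_mul hc0]
    refine ENNReal.ofReal_le_ofReal (mul_le_mul_of_nonneg_left ?_ hc0)
    -- `Σ'_{E_j ≤ u} w_j ≤ B u^ρ ≤ B T^ρ q^{m+1}`
    have hpow : u ^ ρ ≤ T ^ ρ * q ^ (m + 1) := by
      have hu' : u = T * (1 + ((m : ℝ) + 1) * h / T) := by rw [hu]; field_simp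
      have h1T : 0 ≤ 1 + ((m : ℝ) + 1) * h / T := by positivity
      rw [hu', Real.mul_rpow hT.le h1T]
      refine mul_le_mul_of_nonneg_left ?_ hTρ.le
      calc (1 + ((m : ℝ) + 1) * h / T) ^ ρ ≤ (Real.exp (((m : ℝ) + 1) * h / T)) ^ ρ :=
            Real.rpow_le_rpow h1T (by linarith [Real.add_one_le_exp (((m : ℝ) + 1) * h / T)]) hρ
        _ = q ^ (m + 1) := by
            rw [← Real.exp_mul, hq, ← Real.exp_nat_mul]
            congr 1
            push_cast
            ring
    calc ∑' j : ↥({j : J | E j ≤ u} : Set J), w j ≤ B * u ^ ρ := hB u hTu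
      _ ≤ B * (T ^ ρ * q ^ (m + 1)) := mul_le_mul_of_nonneg_left hpow hB0
      _ = B * T ^ ρ * q ^ (m + 1) := by ring
  -- (3) assemble: Tonelli and a geometric series
  have hS : Summable fun j : ↥({j : J | T ≤ E j} : Set J) => w j * Real.exp (-(t * E j)) := (hsum t ht).subtype _
  have hnn : ∀ j : ↥({j : J | T ≤ E j} : Set J), 0 ≤ w j * Real.exp (-(t * E j)) :=
    fun j => mul_nonneg (hw j) (Real.exp_pos _).le
  set C : ℝ := Real.exp (-(t * T)) * (1 - r) * (B * T ^ ρ * q) with hC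
  have hC0 : 0 ≤ C := by rw [hC]; exact mul_nonneg (mul_nonneg (Real.exp_pos _).le (by linarith)) (by positivity)
  have hgeom : HasSum (fun m : ℕ => C * θ ^ m) (C * (1 - θ)⁻¹) :=
    (hasSum_geometric_of_lt_one hθ0.le hθ1).mul_left C
  have hmain : ENNReal.ofReal (∑' j : ↥({j : J | T ≤ E j} : Set J), w j * Real.exp (-(t * E j))) ≤
      ENNReal.ofReal (C * (1 - θ)⁻¹) := by
    rw [ENNReal.ofReal_tsum_of_nonneg hnn hS]
    calc ∑' j : ↥({j : J | T ≤ E j} : Set J), ENNReal.ofReal (w j * Real.exp (-(t * E j)))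
        ≤ ∑' j : ↥({j : J | T ≤ E j} : Set J), ∑' m, a j m := ENNReal.tsum_le_tsum h1
      _ = ∑' m, ∑' j : ↥({j : J | T ≤ E j} : Set J), a j m := ENNReal.tsum_comm
      _ ≤ ∑' m : ℕ, ENNReal.ofReal (C * θ ^ m) := by
          refine ENNReal.tsum_le_tsum fun m => (h2 m).trans (le_of_eq ?_)
          congr 1
          rw [hC, ← hrq, pow_succ, mul_pow]
          ring
      _ = ENNReal.ofReal (C * (1 - θ)⁻¹) := by
          rw [← hgeom.tsum_eq, ENNReal.ofReal_tsum_of_nonneg (fun m => mul_nonneg hC0 (pow_nonneg hθ0.le m))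
            hgeom.summable]
  have hfin : 0 ≤ C * (1 - θ)⁻¹ := mul_nonneg hC0 (inv_nonneg.mpr (by linarith))
  have hreal := (ENNReal.ofReal_le_ofReal_iff hfin).mp hmain
  refine hreal.trans (le_of_eq ?_)
  rw [hC, hθ, hr, hq]
  have hne : (1 - Real.exp (-((t - ρ / T) * h))) ≠ 0 := by rw [← hθ]; linarith
  field_simp

/-- **The Abelian tail bound** (the layer bound at `h → 0⁺`). Under the hypotheses of `tsum_ge_mul_exp_le_layer`:
`Σ'_{j : T ≤ E_j} w_j e^{-tE_j} ≤ B · T^ρ · e^{-tT} · tT/(tT - ρ)` — the discrete form of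
`β ∫_T^∞ B u^ρ e^{-βu} du = B β^{-ρ} Γ(ρ+1, βT) ≤ B T^ρ e^{-βT} · βT/(βT - ρ)`, the integration-by-parts step of
Pappadopulo–Rychkov–Espin–Rattazzi 2012 §4.4 with the classical bound on the incomplete Gamma function in place of its
asymptotics; no integral and no special function enter. [cite: PappadopuloRychkovEspinRattazzi2012PRD, §4.4] -/
theorem tsum_ge_mul_exp_le_of_le_rpow (hw : ∀ j, 0 ≤ w j)
    (hsum : ∀ t : ℝ, 0 < t → Summable fun j => w j * Real.exp (-(t * E j)))
    {B ρ T t : ℝ} (hρ : 0 ≤ ρ) (hT : 0 < T) (ht : 0 < t) (htT : ρ < t * T)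
    (hB : ∀ u : ℝ, T ≤ u → ∑' j : ↥({j : J | E j ≤ u} : Set J), w j ≤ B * u ^ ρ) :
    ∑' j : ↥({j : J | T ≤ E j} : Set J), w j * Real.exp (-(t * E j)) ≤
      B * T ^ ρ * Real.exp (-(t * T)) * (t * T / (t * T - ρ)) := by
  set K : ℝ := B * T ^ ρ * Real.exp (-(t * T)) with hK
  have hκ : 0 < t - ρ / T := by
    rw [sub_pos, div_lt_iff₀ hT]; linarith
  -- the bound holds with the factor `Φ(h)` for every `h > 0` …
  have hbound : ∀ᶠ h : ℝ in 𝓝[>] 0, ∑' j : ↥({j : J | T ≤ E j} : Set J), w j * Real.exp (-(t * E j)) ≤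
      K * ((1 - Real.exp (-(t * h))) * Real.exp (ρ * h / T) / (1 - Real.exp (-((t - ρ / T) * h)))) := by
    filter_upwards [self_mem_nhdsWithin] with h hh
    exact tsum_ge_mul_exp_le_layer hw hsum hρ hT ht htT hh hB
  -- … and `Φ(h) → t/(t - ρ/T)` as `h → 0⁺`
  have hlim : Tendsto (fun h : ℝ => K * ((1 - Real.exp (-(t * h))) * Real.exp (ρ * h / T) /
      (1 - Real.exp (-((t - ρ / T) * h))))) (𝓝[>] 0) (𝓝 (K * (t * 1 / (t - ρ / T)))) := by
    refine Tendsto.const_mul K ?_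
    -- the slopes `(1 - e^{-ah})/h → a` at `0⁺` (derivative of `h ↦ 1 - e^{-ah}` at `0`)
    have hslope : ∀ a : ℝ, Tendsto (fun h : ℝ => (1 - Real.exp (-(a * h))) / h) (𝓝[>] 0) (𝓝 a) := by
      intro a
      have hd : HasDerivAt (fun h : ℝ => 1 - Real.exp (-(a * h))) a 0 := by
        have h1 : HasDerivAt (fun h : ℝ => -(a * h)) (-a) 0 := (hasDerivAt_const_mul a).neg
        have h2 := (h1.exp).const_sub 1
        simp only [mul_zero, neg_zero, Real.exp_zero, mul_neg, one_mul, neg_neg] at h2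
        exact h2
      refine (hd.tendsto_slope_zero_right).congr fun h => ?_
      simp only [zero_add, mul_zero, neg_zero, Real.exp_zero, sub_self, sub_zero, smul_eq_mul]
      rw [div_eq_inv_mul]
    have e1 := hslope t
    have e2 := hslope (t - ρ / T)
    have e3 : Tendsto (fun h : ℝ => Real.exp (ρ * h / T)) (𝓝[>] 0) (𝓝 1) := by
      have hc : Continuous fun h : ℝ => Real.exp (ρ * h / T) :=
        Real.continuous_exp.comp ((continuous_const.mul continuous_id).div_const T)
      have h0 := hc.tendsto 0
      rw [mul_zero, zero_div, Real.exp_zero] at h0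
      exact h0.mono_left nhdsWithin_le_nhds
    refine ((e1.mul e3).div e2 hκ.ne').congr' ?_
    filter_upwards [self_mem_nhdsWithin] with h hh
    have hh0 : (h : ℝ) ≠ 0 := ne_of_gt hh
    have hne : 1 - Real.exp (-((t - ρ / T) * h)) ≠ 0 := by
      have : Real.exp (-((t - ρ / T) * h)) < 1 := Real.exp_lt_one_iff.mpr (by nlinarith [mem_Ioi.mp hh])
      linarith
    simp only [Pi.div_apply]
    rw [mul_div_right_comm, div_div_div_cancel_right₀ hh0, div_mul_eq_mul_div]
  have hmain := ge_of_tendsto hlim hbound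
  refine hmain.trans (le_of_eq ?_)
  have hne1 : t * T - ρ ≠ 0 := by linarith
  have hne2 : t - ρ / T ≠ 0 := hκ.ne'
  rw [hK]
  field_simp

/-- **The sharp asymptotic tail** (PRER 2012 §4.4 for a weighted discrete family). If the mass below `u` is eventually
`≤ (A + δ)u^ρ` for every `δ > 0` (e.g. `(Σ'_{E_j ≤ u} w_j)/u^ρ → A`, Karamata), then for every `t > 0` and `ε > 0`,
eventually in `T`: `Σ'_{j : T ≤ E_j} w_j e^{-tE_j} ≤ (A + ε) T^ρ e^{-tT}` — «`ℒ(β,E_*) ≲ A Γ(ρ+1) β^{-ρ} Γ(ρ+1,E_*β)/Γ(ρ+1)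
∼ A E_*^ρ e^{-E_*β}`». [cite: PappadopuloRychkovEspinRattazzi2012PRD, §4.4] -/
theorem eventually_tsum_ge_mul_exp_le (hw : ∀ j, 0 ≤ w j)
    (hsum : ∀ t : ℝ, 0 < t → Summable fun j => w j * Real.exp (-(t * E j)))
    {A ρ t : ℝ} (hρ : 0 ≤ ρ) (ht : 0 < t)
    (hF : ∀ δ : ℝ, 0 < δ → ∀ᶠ u : ℝ in atTop, ∑' j : ↥({j : J | E j ≤ u} : Set J), w j ≤ (A + δ) * u ^ ρ)
    {ε : ℝ} (hε : 0 < ε) :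
    ∀ᶠ T : ℝ in atTop, ∑' j : ↥({j : J | T ≤ E j} : Set J), w j * Real.exp (-(t * E j)) ≤
      (A + ε) * T ^ ρ * Real.exp (-(t * T)) := by
  obtain ⟨T₀, hT₀⟩ := eventually_atTop.mp (hF (ε / 2) (by linarith))
  -- `A + ε/2 ≥ 0` (the mass is non-negative)
  have hA : 0 ≤ A + ε / 2 := by
    have h1 := hT₀ (max T₀ 1) (le_max_left _ _)
    have h2 : 0 ≤ ∑' j : ↥({j : J | E j ≤ max T₀ 1} : Set J), w j := tsum_nonneg fun j => hw j
    have h3 : 0 < (max T₀ 1) ^ ρ := Real.rpow_pos_of_pos (lt_of_lt_of_le one_pos (le_max_right _ _)) ρ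
    by_contra hneg
    rw [not_le] at hneg
    nlinarith
  -- `tT/(tT - ρ) → 1`
  have hratio : Tendsto (fun T : ℝ => t * T / (t * T - ρ)) atTop (𝓝 1) := by
    have h1 : Tendsto (fun T : ℝ => t * T - ρ) atTop atTop := by
      refine tendsto_atTop_atTop.mpr fun b => ⟨(b + ρ) / t, fun T hT => ?_⟩
      rw [div_le_iff₀ ht] at hT
      linarith
    have h2 : Tendsto (fun T : ℝ => ρ / (t * T - ρ)) atTop (𝓝 0) := tendsto_const_nhds.div_atTop h1
    have h3 := h2.const_add 1
    rw [add_zero] at h3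
    refine h3.congr' ?_
    filter_upwards [eventually_gt_atTop (ρ / t)] with T hT
    rw [div_lt_iff₀ ht] at hT
    have hne : t * T - ρ ≠ 0 := by linarith
    field_simp
    ring
  have hlt : ∀ᶠ T : ℝ in atTop, (A + ε / 2) * (t * T / (t * T - ρ)) < A + ε := by
    have h := (tendsto_const_nhds (x := A + ε / 2)).mul hratio
    rw [mul_one] at h
    exact h.eventually_lt_const (by linarith)
  filter_upwards [hlt, eventually_ge_atTop T₀, eventually_gt_atTop (max 0 (ρ / t))] with T h1 h2 h3
  have hT : 0 < T := lt_of_le_of_lt (le_max_left _ _) h3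
  have htT : ρ < t * T := by
    have h4 := lt_of_le_of_lt (le_max_right _ _) h3
    rw [div_lt_iff₀ ht] at h4
    linarith
  have main := tsum_ge_mul_exp_le_of_le_rpow hw hsum hρ hT ht htT (B := A + ε / 2)
    (fun u hu => hT₀ u (h2.trans hu))
  have hX : 0 ≤ T ^ ρ * Real.exp (-(t * T)) := (mul_pos (Real.rpow_pos_of_pos hT ρ) (Real.exp_pos _)).le
  calc ∑' j : ↥({j : J | T ≤ E j} : Set J), w j * Real.exp (-(t * E j))
      ≤ (A + ε / 2) * T ^ ρ * Real.exp (-(t * T)) * (t * T / (t * T - ρ)) := main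
    _ = (A + ε / 2) * (t * T / (t * T - ρ)) * (T ^ ρ * Real.exp (-(t * T))) := by ring
    _ ≤ (A + ε) * (T ^ ρ * Real.exp (-(t * T))) := mul_le_mul_of_nonneg_right h1.le hX
    _ = (A + ε) * T ^ ρ * Real.exp (-(t * T)) := by ring

/-! ### The strict tail (the complement of the states counted below `T`) -/

/-- **Strict form of the Abelian tail bound**: under the hypotheses of `tsum_ge_mul_exp_le_of_le_rpow`,
`Σ'_{j : T < E_j} w_j e^{-tE_j} ≤ B · T^ρ · e^{-tT} · tT/(tT - ρ)` — the tail over the COMPLEMENT of the states counted by the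
mass `Σ'_{E_j ≤ T} w_j` (a sub-family of the non-strict tail; non-negative terms). [cite: PappadopuloRychkovEspinRattazzi2012PRD, §4.4] -/
theorem tsum_gt_mul_exp_le_of_le_rpow (hw : ∀ j, 0 ≤ w j)
    (hsum : ∀ t : ℝ, 0 < t → Summable fun j => w j * Real.exp (-(t * E j)))
    {B ρ T t : ℝ} (hρ : 0 ≤ ρ) (hT : 0 < T) (ht : 0 < t) (htT : ρ < t * T)
    (hB : ∀ u : ℝ, T ≤ u → ∑' j : ↥({j : J | E j ≤ u} : Set J), w j ≤ B * u ^ ρ) :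
    ∑' j : ↥({j : J | T < E j} : Set J), w j * Real.exp (-(t * E j)) ≤
      B * T ^ ρ * Real.exp (-(t * T)) * (t * T / (t * T - ρ)) := by
  refine le_trans ?_ (tsum_ge_mul_exp_le_of_le_rpow hw hsum hρ hT ht htT hB)
  have hS := hsum t ht
  have h0 : ∀ j, 0 ≤ w j * Real.exp (-(t * E j)) := fun j => mul_nonneg (hw j) (Real.exp_pos _).le
  rw [tsum_subtype ({j : J | T < E j} : Set J) (fun j => w j * Real.exp (-(t * E j))),
    tsum_subtype ({j : J | T ≤ E j} : Set J) (fun j => w j * Real.exp (-(t * E j)))]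
  exact (hS.indicator _).tsum_le_tsum
    (fun j => indicator_le_indicator_of_subset (fun i (hi : T < E i) => le_of_lt hi) h0 j) (hS.indicator _)

end AbelTail

end Summit.CriticalPhenomena.Ising3D.Control2D
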